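import Summits.AtomisticToContinuum.HydrodynamicLimit.Theorems.CollisionIsometryCLTCollisionalTransferLocalityBalanceIdentity
import Summits.AtomisticToContinuum.HydrodynamicLimit.Theorems.CollisionIsometryCLTCollisionalTransferLocalityFluxFormKinematics
import Summits.AtomisticToContinuum.HydrodynamicLimit.Theorems.CollisionIsometryCLTCollisionalTransferLocalityFluxForm
import HarnessLib

/-!
# The streaming derivative of the crux's observable in closed form
(line `hemisphere-affine-slaving`, crux `CollisionalTransferLocality`, stmt-AtomisticToContinuum-9518)

Helper file (`--supports stmt-AtomisticToContinuum-9518`; registered stub `deriv_Obs_freeFlight_eq`) of the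
line lead. The crux's residual `Cc(τ)` keeps the FREE-STREAMING term
`B_s(w) := d/dr|₀ Obs ψ χ N s (S_r w)` abstract (`S_r` the free flight of the torus geometry,
`x_i ↦ x_i + proj (r v_i)`, `v_i` fixed). Here it is computed: particle by particle, along the line
`r ↦ x_i + proj (r v_i)` the derivative of a `C¹` scalar `f` at `r = 0` is `Σ_b v_{i,b} ∂_b f(x_i)`
(`hasDerivAt_lineMap_sum`), applied to the smooth slices `y ↦ ψ(s, y)_a` and `χ(s, ·)`
(`IsSmoothSpaceTimeOn.isSmooth_slice`), and the partial derivatives are the components of the torus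
gradient (`gradient_apply_eq_partialDeriv`), whence
`B_s(w) = (N+1)⁻¹ Σ_i [Σ_a Σ_b ∂_bψ_a(s, x_i) v_{i,a} v_{i,b} + (Σ_a ∂_aχ(s, x_i) v_{i,a}) |v_i|²/2]`.
References: H. Spohn, *Large Scale Dynamics of Interacting Particles* (1991), Part I §3.2 (the
streaming term of the weak balance law).
-/

namespace Summit.AtomisticToContinuum.HydrodynamicLimit.Theorems.HemisphereAffineSlaving

open scoped BigOperators Topology Classical ENNReal InnerProductSpace
open Filter Set Function MeasureTheory
open Literature.Analysis.FunctionSpaces Literature.Analysis.FluidPDE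

noncomputable section

open Literature.MathematicalPhysics.KineticTheory (T3 V3)

namespace StreamingDerivative

/-- The derivative at `r = 0` of a `C¹` scalar along the free-flight line `r ↦ x + proj (r v)`, in
gradient components: `Σ_a ∇f(x)_a v_a`. -/
theorem hasDerivAt_line_zero {f : T3 → ℝ} (hf : Torus.IsContDiff 1 f) (x : T3) (v : V3) :
    HasDerivAt (fun r : ℝ => f (x + Torus.proj (r • v))) (∑ a, Torus.gradient f x a * v a) 0 := by
  have h := hasDerivAt_lineMap_sum hf x v 0
  rw [zero_smul, Torus.proj_zero, add_zero] at h
  refine h.congr_deriv (Finset.sum_congr rfl fun a _ => ?_)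
  rw [gradient_apply_eq_partialDeriv hf x a, mul_comm]

/-- The streaming derivative of ONE particle's term of the observable:
`d/dr|₀ [Σ_j ψ_j(s, x + proj (r v)) v_j + χ(s, x + proj (r v)) |v|²/2]
  = Σ_a Σ_b ∂_bψ_a(s, x) v_a v_b + (Σ_a ∂_aχ(s, x) v_a) |v|²/2`. -/
theorem hasDerivAt_particle {ψ : ℝ → T3 → V3} {χ : ℝ → T3 → ℝ} {s : ℝ}
    (hψ : ∀ a, Torus.IsContDiff 1 fun y => ψ s y a) (hχ : Torus.IsContDiff 1 (χ s)) (x : T3) (v : V3) :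
    HasDerivAt (fun r : ℝ => (∑ j, ψ s (x + Torus.proj (r • v)) j * v j) +
        χ s (x + Torus.proj (r • v)) * (‖v‖ ^ 2 / 2))
      ((∑ a, ∑ b, gradPsi ψ s x a b * v a * v b) + (∑ a, gradChi χ s x a * v a) * (‖v‖ ^ 2 / 2)) 0 := by
  refine (HasDerivAt.fun_sum fun a _ => ?_).add ((hasDerivAt_line_zero hχ x v).mul_const _)
  have h := (hasDerivAt_line_zero (hψ a) x v).mul_const (v a)
  rw [Finset.sum_mul] at h
  refine h.congr_deriv (Finset.sum_congr rfl fun b _ => ?_)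
  simp only [gradPsi]
  ring

end StreamingDerivative

open StreamingDerivative in
/-- **Registered stub `deriv_Obs_freeFlight_eq`** of crux stmt-AtomisticToContinuum-9518 (line
hemisphere-affine-slaving): THE STREAMING DERIVATIVE OF THE CRUX'S OBSERVABLE IN CLOSED FORM. For
space–time tests `ψ, χ` smooth on `[0, t]`, every `N`, configuration `w` and `s ∈ [0, t]`,
`d/dr|₀ Obs ψ χ N s (S_r w) = (N+1)⁻¹ Σ_i [Σ_a Σ_b ∂_bψ_a(s, x_i) v_{i,a} v_{i,b}
  + (Σ_a ∂_aχ(s, x_i) v_{i,a}) |v_i|²/2]` (free flight moves `x_i ↦ x_i + proj (r v_i)` at fixed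
velocities; chain rule along lines on `𝕋³`). -/
theorem deriv_Obs_freeFlight_eq : ∀ {t : ℝ} {ψ : ℝ → T3 → V3} {χ : ℝ → T3 → ℝ}, Literature.Analysis.FunctionSpaces.Torus.IsSmoothSpaceTimeOn (Icc 0 t) ψ → Literature.Analysis.FunctionSpaces.Torus.IsSmoothSpaceTimeOn (Icc 0 t) χ → ∀ (N : ℕ) (w : Cfg N) {s : ℝ}, s ∈ Icc 0 t → deriv (fun r : ℝ => Obs ψ χ N s (Literature.Analysis.FluidPDE.freeFlight (Literature.Analysis.FluidPDE.Torus.geometry (Fin 3)) r w)) 0 = ((N : ℝ) + 1)⁻¹ * ∑ i : Fin (N + 1), ((∑ a, ∑ b, gradPsi ψ s (w i).1 a b * (w i).2 a * (w i).2 b) + (∑ a, gradChi χ s (w i).1 a * (w i).2 a) * (‖(w i).2‖ ^ 2 / 2)) := by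
  intro t ψ χ hψ hχ N w s hs
  have hψ1 : ∀ a, Torus.IsContDiff 1 fun y => ψ s y a := fun a =>
    ((hψ.isSmooth_slice hs).apply a).isContDiff (by simp)
  have hχ1 : Torus.IsContDiff 1 (χ s) := (hχ.isSmooth_slice hs).isContDiff (by simp)
  have H : HasDerivAt (fun r : ℝ => Obs ψ χ N s (freeFlight (Torus.geometry (Fin 3)) r w))
      (((N : ℝ) + 1)⁻¹ * ∑ i : Fin (N + 1), ((∑ a, ∑ b, gradPsi ψ s (w i).1 a b * (w i).2 a * (w i).2 b) +
        (∑ a, gradChi χ s (w i).1 a * (w i).2 a) * (‖(w i).2‖ ^ 2 / 2))) 0 := by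
    simp only [BalanceIdentity.Obs_eq_sum, freeFlight_apply, Torus.geometry_translate]
    exact HasDerivAt.const_mul _ (HasDerivAt.fun_sum fun i _ => hasDerivAt_particle hψ1 hχ1 (w i).1 (w i).2)
  exact H.deriv

end

end Summit.AtomisticToContinuum.HydrodynamicLimit.Theorems.HemisphereAffineSlaving
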